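import Summits.QuantumFields.YangMills.Theorems.BalabanUVNodesN15CurvedGluingAdjointCovariantEntryGlued
import HarnessLib

/-!
# N15 = NE2, road (c) — PROGRAMME (PC), (PC-E-K) ENTRY 2 OF (3.42) (THE ADJOINT ARRANGEMENT): THE COVARIANT ENTRY AT THE GLUED LEVEL THROUGH A GENERAL TRANSPORT `τ` — n15-c FILE 159
# `…CurvedGluingAdjointCovariantEntryGlued` §3 (`hasMaj_idef_comp_mmulOp_plain`, ★★ `hasMaj_idef_gluedCovShape`) with King's block pull-back `pull π` replaced by an ARBITRARY linear transport
# `τ` and the coefficients' row fits `Σ_k|B_f(x′)_{ik} − B(πx′)_{ik}| ≤ o` replaced by the displayed coefficient-defect ROWS `𝔇_τ(M_{B_f}, M_B) ≤ diag o` (dag-n15-c g36, n15-c∕425)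

Cell `pub-ymgap`, seat `pub-ymgap-dag-n15-c` (generation g36; R134 (a) seat, strategy s1 «first missing estimate»; HUMAN RULING D-0062; chair R424 venue).
`bears_on: R4∕N15 · K3⁸ SpineGivenEndpointR13SepCoPHV (stmt-QuantumFields-27366)`; filed `--kind proof --supports stmt-QuantumFields-27366 --as helper` — COUNT-NEUTRAL.
TWO theorems, 0 `def`, 0 `sorry`; bookkeeping over landed single-grid rows, NO new estimate.  Imports BY NAME n15-c FILE 159 `…CurvedGluingAdjointCovariantEntryGlued` (§1 `comp_covShape_bgrad_eq`:
`𝒢∘(M_R∇⁻_e + M_B) = (𝒢∘∇⁻_e)∘M_{R∘e} − 𝒢∘M_{∇R} + 𝒢∘M_B`, §2 `hasMaj_gluedCovShape` (one grid, unchanged); through it dag-n15-w4 `MatrixSpecies.hasMaj_mmulOp`, n15-w3 `hasMaj_comp_diag`, pub-balaban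
`T4EtaRateDefect.idef_comp∕idef_add∕idef_sub`, `T4EtaRateCoeffDefect.diagK`).  Nothing in the tree is modified, no landed name re-declared; each `_tr` theorem is its flat namesake's proof
text with `pull π ↦ τ` and the fit `hfB` (resp. `hfR hfR′ hfB`) replaced by the row `hDB` (resp. `hDR hDR′ hDB`).

WHY.  The entry-2 recipe (dag-n15-c g18 FINDING (ix); executed for the small-field family by n15-c∕179 `sf_idef_bgradCov_cvGlued`): the adjoint glue (n15-c∕423∕424 through the covariant
transport) is applied with the PURE backward gradient `E := ∇⁻_{μ₀} ⊗ 1` as the right factor; the print's `G′∇*_U` in the direction `μ₀` is then `(𝒢∘∇⁻)∘M_{R∘e} − 𝒢∘M_{∇R} + 𝒢∘M_B` for the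
coefficient fields `R, B` of the adjoint covariant derivative (dag-n15-c g27's 284 `covD_symm_eq_bgrad_add` ∕ `covD_symm_covShape`), and its two-grid η-defect THROUGH `τ_{Ad∘U′}` follows from
the η-defects of `𝒢∘∇⁻` (the «K» chain) and of `𝒢` (entry 0, n15-c∕392∕417) and the coefficient-defect rows through `τ` (pairing fits of the transporter letters, n15-c∕415's pattern) — the
last plumbing before the named level (n15-c∕388) and the node's slot 2.  FILE 159 states this plumbing for the FLAT `pull`; THIS FILE is its `τ`-edition.

WHAT.  ★ `hasMaj_idef_comp_mmulOp_tr`: `𝔇_τ(T′∘M_{B_f}, T∘M_B) ≤ (c·o_B + m·r_B)e^{−δd}` from the fine row `T′ ≤ ce^{−δd}`, the `τ`-defect `𝔇_τ(T′,T) ≤ me^{−δd}`, the coarse row sums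
`Σ_k|B(x)_{ik}| ≤ r_B` and the coefficient-defect row `𝔇_τ(M_{B_f}, M_B) ≤ diag o_B` (any `o_B`).  ★★ `hasMaj_idef_gluedCovShape_tr`:
`𝔇_τ(𝒢′_D∘M_{R_f} − 𝒢′∘M_{R′_f} + 𝒢′∘M_{B_f}, 𝒢_D∘M_R − 𝒢∘M_{R′} + 𝒢∘M_B) ≤ [(c_Do_R + m_Dr_R) + (c·o_{R′} + m·r_{R′}) + (c·o_B + m·r_B)]e^{−δd}` — SAME constant as FILE 159.

HONEST FRAMING ∕ LIMITS.  A transport-generic transcription of a landed theorem; no estimate; the rows, `τ`-defects and coefficient-defect rows are HYPOTHESES; MODEL carriers;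
[Balaban1985BackgroundPropagators] (3.42) p.397 (entry 2), (3.64)–(3.65) pp.402–403, Thm 3.14 pp.426–427 = SHAPES ∕ TEMPLATE, nothing printed is asserted.  NE2⁺ NOT PRINTED, NOT proved;
N15 of record untouched (DISCHARGED AS CONSUMED, p687738); K3⁸ OPEN; counts of record UNMOVED (typed 28∕28 · discharged 8∕27); one finite 𝕋⁴ at fixed ε per index — NOT infinite volume,
NOT OS on ℝ⁴, NOT a mass gap, NOT Clay.  Restate-immune (no Theses import).
-/

set_option autoImplicit false

noncomputable section
open scoped BigOperators

namespace Summit.QuantumFields.YangMills.BalabanUVNodes.N15.Gluing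

open Literature.MathematicalPhysics.QuantumFieldTheory.Balaban1983to89
open Literature.MathematicalPhysics.QuantumFieldTheory.Balaban1983to89.B11SectG (BlockNorm HasMaj)
open Literature.MathematicalPhysics.QuantumFieldTheory.Balaban1983to89.T4EtaRateDefect (idef idef_comp idef_add idef_sub)
open Literature.MathematicalPhysics.QuantumFieldTheory.Balaban1983to89.T4EtaRateCoeffDefect (pull diagK diagK_nonneg)
open Summit.QuantumFields.YangMills.BalabanUVNodes.N15.MatrixSpecies (mmulOp liftBlk liftMap hasMaj_mmulOp)

section Rows

variable {X X' ι : Type} [Fintype X] [Fintype X'] [Fintype ι] {g : B6.Geometry} (blk : X → g.Site) (π : X' → X)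
  (τ : (X × ι → ℝ) →ₗ[ℝ] (X' × ι → ℝ))

/-- ★ `𝔇_τ(T′∘M_{B_f}, T∘M_B) ≤ (c·o_B + m·r_B)e^{−δd}` from the fine row `T′ ≤ ce^{−δd}`, the `τ`-defect `𝔇_τ(T′,T) ≤ me^{−δd}`, the coarse row sums `r_B` and the coefficient-defect ROW
`𝔇_τ(M_{B_f}, M_B) ≤ diag o_B` (FILE 159 `hasMaj_idef_comp_mmulOp_plain` with `pull π ↦ τ`; `idef_comp`). [cite: Balaban1985BackgroundPropagators, Thm 3.14 pp.426–427 (difference template)] -/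
theorem hasMaj_idef_comp_mmulOp_tr {T : (X × ι → ℝ) →ₗ[ℝ] (X × ι → ℝ)} {T' : (X' × ι → ℝ) →ₗ[ℝ] (X' × ι → ℝ)} {B : X → Matrix ι ι ℝ} {Bf : X' → Matrix ι ι ℝ} {c m rB oB δ : ℝ}
    (hc : 0 ≤ c) (hm : 0 ≤ m) (hrB : 0 ≤ rB) (hB : ∀ x i, ∑ k, |B x i k| ≤ rB)
    (hDB : HasMaj (BlockNorm.ofBlocks g (liftBlk blk ι)) (BlockNorm.ofBlocks g (liftBlk (blk ∘ π) ι)) (idef τ τ (mmulOp Bf) (mmulOp B)) (diagK fun _ => oB))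
    (hT' : HasMaj (BlockNorm.ofBlocks g (liftBlk (blk ∘ π) ι)) (BlockNorm.ofBlocks g (liftBlk (blk ∘ π) ι)) T' (fun y y' => c * Real.exp (-(δ * g.dist y y'))))
    (hD : HasMaj (BlockNorm.ofBlocks g (liftBlk blk ι)) (BlockNorm.ofBlocks g (liftBlk (blk ∘ π) ι)) (idef τ τ T' T) (fun y y' => m * Real.exp (-(δ * g.dist y y')))) :
    HasMaj (BlockNorm.ofBlocks g (liftBlk blk ι)) (BlockNorm.ofBlocks g (liftBlk (blk ∘ π) ι)) (idef τ τ (T' ∘ₗ mmulOp Bf) (T ∘ₗ mmulOp B))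
      (fun y y' => (c * oB + m * rB) * Real.exp (-(δ * g.dist y y'))) := by
  rw [idef_comp τ τ τ T' (mmulOp Bf) T (mmulOp B)]
  have t1 := hasMaj_comp_diag (liftBlk (blk ∘ π) ι) (fun y y' => mul_nonneg hc (Real.exp_nonneg _)) hT' hDB
  have t2 := hasMaj_comp_diag (liftBlk blk ι) (fun y y' => mul_nonneg hm (Real.exp_nonneg _)) hD (hasMaj_mmulOp (g := g) blk (C := B) (m := fun _ => rB) (fun _ => hrB) hB)
  refine (t1.add t2).mono fun y y' => le_of_eq ?_
  ring

/-- ★★ **THE TWO-GRID η-DEFECT OF THE GLUED COVARIANT ENTRY THROUGH `τ`** — FILE 159 `hasMaj_idef_gluedCovShape` with `pull π ↦ τ`: fine rows `𝒢′_D ≤ c_D`, `𝒢′ ≤ c`, `τ`-defects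
`𝔇_τ(𝒢′_D, 𝒢_D) ≤ m_D`, `𝔇_τ(𝒢′, 𝒢) ≤ m` (rate `δ`), coarse coefficient row sums `r_R, r_{R′}, r_B`, coefficient-defect rows `o_R, o_{R′}, o_B` through `τ` ⟹
`𝔇_τ(𝒢′_D∘M_{R_f} − 𝒢′∘M_{R′_f} + 𝒢′∘M_{B_f}, 𝒢_D∘M_R − 𝒢∘M_{R′} + 𝒢∘M_B) ≤ [(c_Do_R + m_Dr_R) + (c·o_{R′} + m·r_{R′}) + (c·o_B + m·r_B)]e^{−δd}`.
[cite: Balaban1985BackgroundPropagators, Thm 3.14 pp.426–427 (difference template), (3.42) p.397 (entry 2: shape), (3.64)–(3.65) pp.402–403] -/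
theorem hasMaj_idef_gluedCovShape_tr {G GD : (X × ι → ℝ) →ₗ[ℝ] (X × ι → ℝ)} {G' GD' : (X' × ι → ℝ) →ₗ[ℝ] (X' × ι → ℝ)} {R R' B : X → Matrix ι ι ℝ} {Rf Rf' Bf : X' → Matrix ι ι ℝ}
    {c cD m mD rR rR' rB oR oR' oB δ : ℝ} (hc : 0 ≤ c) (hcD : 0 ≤ cD) (hm : 0 ≤ m) (hmD : 0 ≤ mD) (hrR : 0 ≤ rR) (hrR' : 0 ≤ rR') (hrB : 0 ≤ rB)
    (hR : ∀ x i, ∑ k, |R x i k| ≤ rR) (hR' : ∀ x i, ∑ k, |R' x i k| ≤ rR') (hB : ∀ x i, ∑ k, |B x i k| ≤ rB)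
    (hDR : HasMaj (BlockNorm.ofBlocks g (liftBlk blk ι)) (BlockNorm.ofBlocks g (liftBlk (blk ∘ π) ι)) (idef τ τ (mmulOp Rf) (mmulOp R)) (diagK fun _ => oR))
    (hDR' : HasMaj (BlockNorm.ofBlocks g (liftBlk blk ι)) (BlockNorm.ofBlocks g (liftBlk (blk ∘ π) ι)) (idef τ τ (mmulOp Rf') (mmulOp R')) (diagK fun _ => oR'))
    (hDB : HasMaj (BlockNorm.ofBlocks g (liftBlk blk ι)) (BlockNorm.ofBlocks g (liftBlk (blk ∘ π) ι)) (idef τ τ (mmulOp Bf) (mmulOp B)) (diagK fun _ => oB))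
    (hGD' : HasMaj (BlockNorm.ofBlocks g (liftBlk (blk ∘ π) ι)) (BlockNorm.ofBlocks g (liftBlk (blk ∘ π) ι)) GD' (fun y y' => cD * Real.exp (-(δ * g.dist y y'))))
    (hG' : HasMaj (BlockNorm.ofBlocks g (liftBlk (blk ∘ π) ι)) (BlockNorm.ofBlocks g (liftBlk (blk ∘ π) ι)) G' (fun y y' => c * Real.exp (-(δ * g.dist y y'))))
    (hDGD : HasMaj (BlockNorm.ofBlocks g (liftBlk blk ι)) (BlockNorm.ofBlocks g (liftBlk (blk ∘ π) ι)) (idef τ τ GD' GD) (fun y y' => mD * Real.exp (-(δ * g.dist y y'))))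
    (hDG : HasMaj (BlockNorm.ofBlocks g (liftBlk blk ι)) (BlockNorm.ofBlocks g (liftBlk (blk ∘ π) ι)) (idef τ τ G' G) (fun y y' => m * Real.exp (-(δ * g.dist y y')))) :
    HasMaj (BlockNorm.ofBlocks g (liftBlk blk ι)) (BlockNorm.ofBlocks g (liftBlk (blk ∘ π) ι))
      (idef τ τ (GD' ∘ₗ mmulOp Rf - G' ∘ₗ mmulOp Rf' + G' ∘ₗ mmulOp Bf) (GD ∘ₗ mmulOp R - G ∘ₗ mmulOp R' + G ∘ₗ mmulOp B))
      (fun y y' => (((cD * oR + mD * rR) + (c * oR' + m * rR')) + (c * oB + m * rB)) * Real.exp (-(δ * g.dist y y'))) := by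
  rw [idef_add, idef_sub]
  refine (((hasMaj_idef_comp_mmulOp_tr blk π τ hcD hmD hrR hR hDR hGD' hDGD).sub (hasMaj_idef_comp_mmulOp_tr blk π τ hc hm hrR' hR' hDR' hG' hDG)).add
    (hasMaj_idef_comp_mmulOp_tr blk π τ hc hm hrB hB hDB hG' hDG)).mono fun y y' => le_of_eq ?_
  ring

end Rows

end Summit.QuantumFields.YangMills.BalabanUVNodes.N15.Gluing

end
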